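import Literature.NumberTheory.Sieve.HeathBrownCubicSieveDecomposition
import Literature.NumberTheory.Sieve.HeathBrownMorozResidueClasses
import HarnessLib

/-!
# The residue-class subfamily of Heath-Brown's `𝒜^(K)` (Heath-Brown–Moroz 2004, §3): objects and Lemma 3.4

D. R. Heath-Brown and B. Z. Moroz, *On the representation of primes by cubic polynomials in two
variables*, Proc. LMS (3) 88 (2004) 289–312 [HeathBrownMoroz2004], prove their Theorem 2 (primes
`x³ + 2y³` with `(x, y)` in an admissible residue class `(a, b) mod d`, the tree's named fact
`CubicPrimes.HeathBrownMoroz2004_residueClass`) by re-running Heath-Brown's argument [HeathBrownActa2001]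
for the class sub-sequence: "The asymptotic formula (1.2) of Theorem 2 is equivalent to the following
estimate to be proved along the lines of [3, 4]: `π(𝒜) = κπ(ℬ) + O(η²X²τ/log X)` (3.2)" (p. 16 of the
render), with the SAME comparison family `ℬ` and the sieve decomposition of [3, §3] taken over verbatim
("We adopt the sieve notation introduced in [4, §4]").

The tree's decomposition (`HeathBrownCubicSieveDecomposition`) is already generic in the family
`(E, I)`; this file sets up the class family in Heath-Brown's own frame — the members `(x + y·2^{1/3})`
of `𝒜^(K)` (`boxPairs X η`, `pairIdeal`) whose index `(x, y)` lies in the class `x ≡ a`, `y ≡ b (mod d)`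
— and proves the class version of Lemma 3.4 (the exact decomposition inequality), the vanishing of the
class Type-I counts at ideals not coprime to `d`, and the dictionary with the count
`CubicPrimes.residueClassPrimeCount` of `HeathBrownMorozResidueClasses` (quotient coordinates
`x = a + dx₁`).  Contents (namespace `Literature.NumberTheory.Sieve.CubicSieve`):

* `classPairs X η d a b` (the index set), `classAPairs`/`classCountA` (`𝒜_R` and `#𝒜_R` for the
  class), `classPrimeCount` (`π(𝒜)` for the class), `classKappa σ₀ X η d = (w(d)/d²)·κ` (the comparison
  constant: HBM's `κ = σ₁(f)η(h_f X)^{-1}` in Heath-Brown's frame, `σ₁ = σ₀ w(d)`, (3.1));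
* `classPairs_subset_boxPairs`, `classAPairs_subset_APairs`, `classCountA_le_countA`,
  `classPrimeCount_eq_famSifted` (`π(𝒜_class) = S_K(𝒜_class^(K), 2X^{3/2})`);
* `coprime_cubicForm_of_mem_classPairs`, **`classAPairs_eq_empty_of_not_coprime`** — in an admissible
  class no member is divisible by an ideal `R` with `(N R, d) > 1` (HBM Lemma 2.4: `Γ(p) = 0` for `p ∣ d`);
* **`HeathBrownMoroz2004_lemma_3_4`** — Lemma 3.4 of [3] for the class family (proof = the tree's
  `HeathBrown2001_lemma_3_4` with `boxPairs` replaced by `classPairs`; any `κ ≥ 0`).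

## References

* [HeathBrownMoroz2004] §3, p. 16 of the render: (3.2) and "Lemmata 3.5, 3.6, and 4.1 in [4] can be
  taken over verbatim"; (3.1) `σ₁(f)`; Lemma 2.4. [cite: HeathBrownMoroz2004, §3 (3.2)]
* [HeathBrownActa2001] D. R. Heath-Brown, Acta Math. 186 (2001), §3 pp. 10–14, Lemma 3.4.
  [cite: HeathBrownActa2001, Lemma 3.4]

## Mathlib / tree search

Tree: `boxPairs`, `pairIdeal`, `APairs`, `countA`, `normWindow`, `normPrimeCount`, `kappa`, `famSifted`,
`famSifted_top_decomposition`, `pairIdeal_ne_bot_of_mem_boxPairs`, `ne_bot_of_mem_normWindow`,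
`siftedB_eq_famSifted`, `siftedB_one_eq_normPrimeCount_add`, `card_normWindow_isPrime_not_prime_le`,
`abs_sum_neg_one_pow_mul_le`, `prime_iff_isRough_pairIdeal`, `absNorm_pairIdeal(_mem_Ioo)`,
`two_mul_rpow_three_halves_sq`, `rpow_three_halves_le_pow_three` (`HeathBrownCubicSieveSetup/Decomposition`);
`classWeight`, `residueClassPrimePairs` (`HeathBrownMorozResidueClasses`). `lean search 'classPairs'`: only
a sketch decl in `Summits/Parity/.../Cruxes/HeathBrownMorozUniform/IdeaSketch1.lean` (different namespace).
-/

noncomputable section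

open Polynomial NumberField Finset Filter Topology

namespace Literature.NumberTheory.Sieve.CubicSieve

open LFunctions.CubeRootTwoField CubicPrimes

/-! ### The class family -/

/-- The index set of the CLASS family: the pairs `(x, y)` of Heath-Brown's `𝒜^(K)` (`X < x, y ≤ X(1+η)`,
`(x, y) = 1`) with `x ≡ a`, `y ≡ b (mod d)` — Heath-Brown–Moroz's sequence `𝒜` for the class
`γ = a + b·2^{1/3}` modulo `d`, in Heath-Brown's frame (height `X`, box side `ηX`).
[cite: HeathBrownMoroz2004, §1 (1.1)–(1.2) and §3 (3.2)] -/
def classPairs (X η : ℝ) (d a b : ℕ) : Finset (ℕ × ℕ) :=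
  {xy ∈ boxPairs X η | xy.1 ≡ a [MOD d] ∧ xy.2 ≡ b [MOD d]}

/-- Membership in `classPairs`. [cite: HeathBrownMoroz2004, §1 (1.1)] -/
theorem mem_classPairs_iff {X η : ℝ} {d a b : ℕ} {xy : ℕ × ℕ} :
    xy ∈ classPairs X η d a b ↔ xy ∈ boxPairs X η ∧ xy.1 ≡ a [MOD d] ∧ xy.2 ≡ b [MOD d] := by
  rw [classPairs, mem_filter]

/-- The class family is a subfamily of `𝒜^(K)`. [cite: HeathBrownMoroz2004, §3] -/
theorem classPairs_subset_boxPairs (X η : ℝ) (d a b : ℕ) : classPairs X η d a b ⊆ boxPairs X η :=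
  filter_subset _ _

/-- For `d = 1` the class family is all of `𝒜^(K)`. [cite: HeathBrownMoroz2004, §3] -/
theorem classPairs_one (X η : ℝ) (a b : ℕ) : classPairs X η 1 a b = boxPairs X η :=
  filter_true_of_mem fun _ _ => ⟨Nat.modEq_one, Nat.modEq_one⟩

open scoped Classical in
/-- `𝒜_R` for the class: the members of the class family divisible by the ideal `R`.
[cite: HeathBrownMoroz2004, §2 (2.4)] -/
def classAPairs (X η : ℝ) (d a b : ℕ) (R : Ideal (𝓞 K)) : Finset (ℕ × ℕ) :=
  {xy ∈ classPairs X η d a b | R ∣ pairIdeal xy}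

/-- `#𝒜_R` for the class — the quantity of the class Type-I bound (HBM Lemma 2.3 / [3, Lemma 3.2]).
[cite: HeathBrownMoroz2004, Lemma 2.3] -/
def classCountA (X η : ℝ) (d a b : ℕ) (R : Ideal (𝓞 K)) : ℕ := #(classAPairs X η d a b R)

/-- Membership in `classAPairs`. [cite: HeathBrownMoroz2004, §2 (2.4)] -/
theorem mem_classAPairs_iff {X η : ℝ} {d a b : ℕ} {R : Ideal (𝓞 K)} {xy : ℕ × ℕ} :
    xy ∈ classAPairs X η d a b R ↔ xy ∈ classPairs X η d a b ∧ R ∣ pairIdeal xy := by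
  classical
  rw [classAPairs, mem_filter]

/-- `𝒜_R(class) ⊆ 𝒜^(K)_R`. [cite: HeathBrownMoroz2004, §2] -/
theorem classAPairs_subset_APairs (X η : ℝ) (d a b : ℕ) (R : Ideal (𝓞 K)) :
    classAPairs X η d a b R ⊆ APairs X η R := by
  intro xy hxy
  rw [mem_classAPairs_iff] at hxy
  exact mem_APairs_iff.2 ⟨classPairs_subset_boxPairs X η d a b hxy.1, hxy.2⟩

/-- `#𝒜_R(class) ≤ #𝒜^(K)_R`. [cite: HeathBrownMoroz2004, §2] -/
theorem classCountA_le_countA (X η : ℝ) (d a b : ℕ) (R : Ideal (𝓞 K)) :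
    classCountA X η d a b R ≤ countA X η R :=
  card_le_card (classAPairs_subset_APairs X η d a b R)

/-- `π(𝒜)` for the class: the members of the class family with `x³ + 2y³` prime.
[cite: HeathBrownMoroz2004, §3 (3.2)] -/
def classPrimeCount (X η : ℝ) (d a b : ℕ) : ℕ :=
  #{xy ∈ classPairs X η d a b | (xy.1 ^ 3 + 2 * xy.2 ^ 3).Prime}

/-- `classPrimeCount` unfolded. [cite: HeathBrownMoroz2004, §3 (3.2)] -/
theorem classPrimeCount_def (X η : ℝ) (d a b : ℕ) :
    classPrimeCount X η d a b = #{xy ∈ classPairs X η d a b | (xy.1 ^ 3 + 2 * xy.2 ^ 3).Prime} := rfl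

/-- `π(𝒜_class) ≤ π(𝒜)`. [cite: HeathBrownMoroz2004, §3] -/
theorem classPrimeCount_le_primePairCount (X η : ℝ) (d a b : ℕ) :
    classPrimeCount X η d a b ≤ primePairCount X η := by
  rw [classPrimeCount, primePairCount_def, primePairs_eq_filter]
  exact card_le_card (fun xy hxy => by
    rw [mem_filter] at hxy ⊢
    exact ⟨classPairs_subset_boxPairs X η d a b hxy.1, hxy.2⟩)

/-- The comparison constant of the class: `κ_d = (w(d)/d²)·κ`, `κ = σ₀η(3X)^{-1}` — HBM's
`κ = σ₁(f)η(h_f X)^{-1}` with `σ₁ = σ₀·w(d)` ((3.1)) read in Heath-Brown's frame (the class has density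
`w(d)/d²` in `𝒜^(K)`: `∑_{adm. classes} w(d) = d²`). [cite: HeathBrownMoroz2004, §3 (3.1)–(3.2)] -/
def classKappa (σ₀ X η : ℝ) (d : ℕ) : ℝ := classWeight d / (d : ℝ) ^ 2 * kappa σ₀ X η

/-- `classKappa` unfolded. [cite: HeathBrownMoroz2004, §3 (3.1)] -/
theorem classKappa_def (σ₀ X η : ℝ) (d : ℕ) :
    classKappa σ₀ X η d = classWeight d / (d : ℝ) ^ 2 * kappa σ₀ X η := rfl

/-- `κ_d ≥ 0` for `σ₀, X, η ≥ 0` (`w(d) > 0`, `κ = σ₀η/(3X) ≥ 0`). [cite: HeathBrownMoroz2004, §3 (3.1)] -/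
theorem classKappa_nonneg {σ₀ X η : ℝ} (hσ : 0 ≤ σ₀) (hX : 0 ≤ X) (hη : 0 ≤ η) (d : ℕ) :
    0 ≤ classKappa σ₀ X η d := by
  rw [classKappa, kappa_def]
  have := classWeight_pos d
  positivity

/-! ### Admissible classes: no member is divisible by an ideal not coprime to `d` -/

/-- In an admissible class (`gcd(a³ + 2b³, d) = 1`) every member's value `x³ + 2y³` is coprime to `d`.
[cite: HeathBrownMoroz2004, Lemma 2.4] -/
theorem coprime_cubicForm_of_mem_classPairs {X η : ℝ} {d a b : ℕ} (hadm : Nat.Coprime (a ^ 3 + 2 * b ^ 3) d)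
    {xy : ℕ × ℕ} (hxy : xy ∈ classPairs X η d a b) : Nat.Coprime (xy.1 ^ 3 + 2 * xy.2 ^ 3) d := by
  obtain ⟨-, ha, hb⟩ := mem_classPairs_iff.1 hxy
  have h : xy.1 ^ 3 + 2 * xy.2 ^ 3 ≡ a ^ 3 + 2 * b ^ 3 [MOD d] := (ha.pow 3).add ((hb.pow 3).mul_left 2)
  rw [Nat.Coprime, h.gcd_eq]
  exact hadm

/-- **`𝒜_R(class) = ∅` unless `(N R, d) = 1`** (admissible class): if `R ∣ (x + y·2^{1/3})` then
`N R ∣ x³ + 2y³`, which is coprime to `d`. This is the vanishing `Γ(p) = 0` (`p ∣ d`) of HBM Lemma 2.4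
at the level of the members. [cite: HeathBrownMoroz2004, Lemma 2.4] -/
theorem classAPairs_eq_empty_of_not_coprime {X η : ℝ} {d a b : ℕ} (hadm : Nat.Coprime (a ^ 3 + 2 * b ^ 3) d)
    {R : Ideal (𝓞 K)} (hR : ¬ Nat.Coprime (Ideal.absNorm R) d) : classAPairs X η d a b R = ∅ := by
  refine eq_empty_of_forall_notMem fun xy hxy => hR ?_
  obtain ⟨hcl, hdvd⟩ := mem_classAPairs_iff.1 hxy
  have h1 : Ideal.absNorm R ∣ xy.1 ^ 3 + 2 * xy.2 ^ 3 := by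
    rw [← absNorm_pairIdeal]
    exact Ideal.absNorm_dvd_absNorm_of_le (Ideal.le_of_dvd hdvd)
  exact Nat.Coprime.coprime_dvd_left h1 (coprime_cubicForm_of_mem_classPairs hadm hcl)

/-- Hence `#𝒜_R(class) = 0` unless `(N R, d) = 1`. [cite: HeathBrownMoroz2004, Lemma 2.4] -/
theorem classCountA_eq_zero_of_not_coprime {X η : ℝ} {d a b : ℕ} (hadm : Nat.Coprime (a ^ 3 + 2 * b ^ 3) d)
    {R : Ideal (𝓞 K)} (hR : ¬ Nat.Coprime (Ideal.absNorm R) d) : classCountA X η d a b R = 0 := by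
  rw [classCountA, classAPairs_eq_empty_of_not_coprime hadm hR, card_empty]

/-! ### `π(𝒜_class)` as a sifting function, and Lemma 3.4 for the class -/

open scoped Classical in
/-- **`π(𝒜_class) = S_K(𝒜_class^(K), 2X^{3/2})`** (`X ≥ 1`, `0 ≤ η ≤ 1/10`): as for the full family
(`primePairCount_eq_siftedA`), a member is `2X^{3/2}`-rough iff its norm `x³ + 2y³ ∈ (3X³, 4X³)` is
prime. [cite: HeathBrownActa2001, §3 p. 11] -/
theorem classPrimeCount_eq_famSifted {X η : ℝ} (hX : 1 ≤ X) (hη0 : 0 ≤ η) (hη : η ≤ 1 / 10) (d a b : ℕ) :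
    classPrimeCount X η d a b = famSifted (classPairs X η d a b) pairIdeal 1 (2 * X ^ (3 / 2 : ℝ)) := by
  classical
  rw [classPrimeCount, famSifted]
  refine congr_arg _ (filter_congr fun xy hxy => ?_)
  simp only [one_dvd, true_and]
  have hX0 : 0 < X := by linarith
  have hbox := classPairs_subset_boxPairs X η d a b hxy
  obtain ⟨hgt, hlt⟩ := absNorm_pairIdeal_mem_Ioo hX0 hη0 hη hbox
  rw [mem_boxPairs_iff] at hbox
  obtain ⟨hx1, -, -, -, hcop⟩ := hbox
  have hxne : xy.1 ≠ 0 := by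
    rintro h
    rw [h, Nat.cast_zero] at hx1
    linarith
  have h32 := rpow_three_halves_le_pow_three hX
  refine prime_iff_isRough_pairIdeal hcop (pairIdeal_ne_bot (Or.inl hxne)) (by positivity)
    (by linarith) ?_
  rw [two_mul_rpow_three_halves_sq hX0]
  exact hlt

/-- The members of the class family are nonzero ideals (`x > X ≥ 0`). [cite: HeathBrownMoroz2004, §3 (3.2)] -/
theorem pairIdeal_ne_bot_of_mem_classPairs {X η : ℝ} (hX : 0 ≤ X) (d a b : ℕ) :
    ∀ xy ∈ classPairs X η d a b, pairIdeal xy ≠ ⊥ := fun xy hxy =>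
  pairIdeal_ne_bot_of_mem_boxPairs hX xy (classPairs_subset_boxPairs X η d a b hxy)

/-- **Heath-Brown's Lemma 3.4 for the class family** (Heath-Brown–Moroz 2004, §3: the decomposition of
[3, §3] "taken over verbatim" for the class sequence `𝒜` and the same `ℬ`), in the exact form of the tree's
`HeathBrown2001_lemma_3_4` and for ANY `κ ≥ 0` (the class uses `κ_d = classKappa σ₀ X η d`): for `X ≥ 2`,
`0 ≤ η ≤ 1/10`, `0 < τ ≤ 1/4`,
`|π(𝒜_cl) − κπ(ℬ)| ≤ 3κ(√(3X³(1+η)) + 1) + ∑_{n≤n₀}|T^(n)(𝒜_cl) − κT^(n)(ℬ)| + |U₁^(1)(𝒜_cl) − κU₁^(1)(ℬ)|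
 + |U₁^(2)(𝒜_cl) − κU₁^(2)(ℬ)| + ∑_{3≤n≤n₀}|U^(n)(𝒜_cl) − κU^(n)(ℬ)| + |U₂^(1)(𝒜_cl) − κU₂^(1)(ℬ)|
 + ∑_{j=3,5,6,7}(S_j(𝒜_cl) + κS_j(ℬ)) + |S₄(𝒜_cl) − κS₄(ℬ)|`.
[cite: HeathBrownMoroz2004, §3 (3.2)] [cite: HeathBrownActa2001, Lemma 3.4] -/
theorem HeathBrownMoroz2004_lemma_3_4 {X η τ κ : ℝ} (hX : 2 ≤ X) (hη0 : 0 ≤ η) (hη : η ≤ 1 / 10)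
    (hτ0 : 0 < τ) (hτ : τ ≤ 1 / 4) (hκ : 0 ≤ κ) (d a b : ℕ) :
    |(classPrimeCount X η d a b : ℝ) - κ * normPrimeCount X η| ≤
      κ * (3 * (Real.sqrt (3 * X ^ 3 * (1 + η)) + 1))
      + ∑ n ∈ range (chainBound τ + 1),
          |(Tpiece (classPairs X η d a b) pairIdeal X τ n : ℝ) -
              κ * Tpiece (normWindow X η) (fun J => J) X τ n|
      + |(U1piece (classPairs X η d a b) pairIdeal X τ 1 : ℝ) -
            κ * U1piece (normWindow X η) (fun J => J) X τ 1|
      + |(U1piece (classPairs X η d a b) pairIdeal X τ 2 : ℝ) -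
            κ * U1piece (normWindow X η) (fun J => J) X τ 2|
      + ∑ n ∈ Icc 3 (chainBound τ),
          |(Upiece (classPairs X η d a b) pairIdeal X τ n : ℝ) -
              κ * Upiece (normWindow X η) (fun J => J) X τ n|
      + |(U2one (classPairs X η d a b) pairIdeal X τ : ℝ) - κ * U2one (normWindow X η) (fun J => J) X τ|
      + (((S₃ (classPairs X η d a b) pairIdeal X τ : ℝ) + κ * S₃ (normWindow X η) (fun J => J) X τ)
        + ((S₅ (classPairs X η d a b) pairIdeal X τ : ℝ) + κ * S₅ (normWindow X η) (fun J => J) X τ)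
        + ((S₆ (classPairs X η d a b) pairIdeal X τ : ℝ) + κ * S₆ (normWindow X η) (fun J => J) X τ)
        + ((S₇ (classPairs X η d a b) pairIdeal X τ : ℝ) + κ * S₇ (normWindow X η) (fun J => J) X τ))
      + |(S₄ (classPairs X η d a b) pairIdeal X τ : ℝ) - κ * S₄ (normWindow X η) (fun J => J) X τ| := by
  classical
  have hX0 : 0 ≤ X := by linarith
  have hX1 : 1 ≤ X := by linarith
  set EA := classPairs X η d a b with hEA
  set EB := normWindow X η with hEB
  set IB : Ideal (𝓞 K) → Ideal (𝓞 K) := fun J => J with hIB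
  set N := chainBound τ with hN
  set TA : ℕ → ℝ := fun n => (Tpiece EA pairIdeal X τ n : ℝ) with hTA
  set TB : ℕ → ℝ := fun n => (Tpiece EB IB X τ n : ℝ) with hTB
  set UA : ℕ → ℝ := fun n => (Upiece EA pairIdeal X τ n : ℝ) with hUA
  set UB : ℕ → ℝ := fun n => (Upiece EB IB X τ n : ℝ) with hUB
  have hπA : (classPrimeCount X η d a b : ℝ) = famSifted EA pairIdeal 1 (2 * X ^ (3 / 2 : ℝ)) := by
    exact_mod_cast classPrimeCount_eq_famSifted hX1 hη0 hη d a b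
  set corr : ℝ := (#{P ∈ normWindow X η | P.IsPrime ∧ ¬ (Ideal.absNorm P).Prime} : ℝ) with hcorr_def
  have hcorr : corr ≤ 3 * (Real.sqrt (3 * X ^ 3 * (1 + η)) + 1) :=
    card_normWindow_isPrime_not_prime_le hX0
  have hcorr0 : 0 ≤ corr := Nat.cast_nonneg _
  have hπB : (normPrimeCount X η : ℝ) = famSifted EB IB 1 (2 * X ^ (3 / 2 : ℝ)) - corr := by
    have h := siftedB_one_eq_normPrimeCount_add hX1 hη0 (by linarith : η < 1 / 3)
    rw [siftedB_eq_famSifted] at h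
    have h' := congr_arg (Nat.cast : ℕ → ℝ) h
    push_cast at h'
    rw [hcorr_def, hEB, hIB]
    linarith
  have hA := famSifted_top_decomposition EA pairIdeal X τ (pairIdeal_ne_bot_of_mem_classPairs hX0 d a b)
    hX hτ0 hτ
  have hB := famSifted_top_decomposition EB IB X τ (ne_bot_of_mem_normWindow hX0) hX hτ0 hτ
  have eT : ∑ n ∈ range (N + 1), (-1) ^ n * TA n - κ * ∑ n ∈ range (N + 1), (-1) ^ n * TB n =
      ∑ n ∈ range (N + 1), (-1) ^ (n + 0) * (TA n - κ * TB n) := by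
    rw [mul_sum, ← sum_sub_distrib]
    exact sum_congr rfl fun n _ => by ring
  have eU : ∑ n ∈ Icc 3 N, (-1) ^ (n + 1) * UA n - κ * ∑ n ∈ Icc 3 N, (-1) ^ (n + 1) * UB n =
      ∑ n ∈ Icc 3 N, (-1) ^ (n + 1) * (UA n - κ * UB n) := by
    rw [mul_sum, ← sum_sub_distrib]
    exact sum_congr rfl fun n _ => by ring
  have key : (classPrimeCount X η d a b : ℝ) - κ * normPrimeCount X η =
      ∑ n ∈ range (N + 1), (-1) ^ (n + 0) * (TA n - κ * TB n)
      + ((U1piece EA pairIdeal X τ 1 : ℝ) - κ * U1piece EB IB X τ 1)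
      + ((S₆ EA pairIdeal X τ : ℝ) - κ * S₆ EB IB X τ)
      + ((U2one EA pairIdeal X τ : ℝ) - κ * U2one EB IB X τ)
      - ((U1piece EA pairIdeal X τ 2 : ℝ) - κ * U1piece EB IB X τ 2)
      - ((S₇ EA pairIdeal X τ : ℝ) - κ * S₇ EB IB X τ)
      + ∑ n ∈ Icc 3 N, (-1) ^ (n + 1) * (UA n - κ * UB n)
      - ((S₃ EA pairIdeal X τ : ℝ) - κ * S₃ EB IB X τ)
      - ((S₄ EA pairIdeal X τ : ℝ) - κ * S₄ EB IB X τ)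
      - ((S₅ EA pairIdeal X τ : ℝ) - κ * S₅ EB IB X τ)
      + κ * corr := by
    rw [hπA, hπB, hA, hB, ← eT, ← eU]
    ring
  have b1 := abs_sum_neg_one_pow_mul_le (range (N + 1)) (fun n => TA n - κ * TB n) 0
  have b2 := abs_sum_neg_one_pow_mul_le (Icc 3 N) (fun n => UA n - κ * UB n) 1
  have b1' := abs_le.mp b1
  have b2' := abs_le.mp b2
  have b3 := abs_le.mp (le_refl |(U1piece EA pairIdeal X τ 1 : ℝ) - κ * U1piece EB IB X τ 1|)
  have b4 := abs_le.mp (le_refl |(U1piece EA pairIdeal X τ 2 : ℝ) - κ * U1piece EB IB X τ 2|)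
  have b5 := abs_le.mp (le_refl |(U2one EA pairIdeal X τ : ℝ) - κ * U2one EB IB X τ|)
  have b6 := abs_le.mp (le_refl |(S₄ EA pairIdeal X τ : ℝ) - κ * S₄ EB IB X τ|)
  have s3A : (0 : ℝ) ≤ S₃ EA pairIdeal X τ := Nat.cast_nonneg _
  have s3B : (0 : ℝ) ≤ κ * S₃ EB IB X τ := mul_nonneg hκ (Nat.cast_nonneg _)
  have s5A : (0 : ℝ) ≤ S₅ EA pairIdeal X τ := Nat.cast_nonneg _
  have s5B : (0 : ℝ) ≤ κ * S₅ EB IB X τ := mul_nonneg hκ (Nat.cast_nonneg _)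
  have s6A : (0 : ℝ) ≤ S₆ EA pairIdeal X τ := Nat.cast_nonneg _
  have s6B : (0 : ℝ) ≤ κ * S₆ EB IB X τ := mul_nonneg hκ (Nat.cast_nonneg _)
  have s7A : (0 : ℝ) ≤ S₇ EA pairIdeal X τ := Nat.cast_nonneg _
  have s7B : (0 : ℝ) ≤ κ * S₇ EB IB X τ := mul_nonneg hκ (Nat.cast_nonneg _)
  have hc1 : κ * corr ≤ κ * (3 * (Real.sqrt (3 * X ^ 3 * (1 + η)) + 1)) :=
    mul_le_mul_of_nonneg_left hcorr hκ
  have hc0 : 0 ≤ κ * corr := mul_nonneg hκ hcorr0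
  rw [key]
  refine abs_le.mpr ⟨?_, ?_⟩
  · linarith [b1'.1, b2'.1, b3.1, b4.1, b5.1, b6.1]
  · linarith [b1'.2, b2'.2, b3.2, b4.2, b5.2, b6.2]

end Literature.NumberTheory.Sieve.CubicSieve

end
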